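import Literature.NumberTheory.EllipticCurves.KolyvaginShaStructure
import Literature.NumberTheory.EllipticCurves.BSDQuadraticDescentShaOddPartGeneralProofs
import Literature.NumberTheory.EllipticCurves.Rank1Residual.Typed.Basic
import Literature.NumberTheory.EllipticCurves.Rank1Residual.Predicates
import HarnessLib

/-!
# LOWER half / `#Ш[p^∞]` per pair from ONE non-divisible derived Heegner point under IRREDUCIBLE
# (not necessarily surjective) `ρ̄_{E,p}` — Matar–Nekovář 2019 Thm. 0.7 / §0.11 (total order) +
# the odd-part quadratic descent; the O8 / EXOTIC-image companion of
# `X4RankZeroLowerKolyvaginDerived.lean` (cell `b2b-bsdres`, team n1011, seat p10, row T-LOWKS-irr)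

HONEST FRAMING (cell `b2b-bsdres`, run/shared/lean/b2b/bsd-rank1-residual/, verbatim in every
file): the goal of the cell is to DELETE the COMBINATION-SHAPED residual classes of the
Birch–Swinnerton-Dyer formula for ALL analytic-rank `≤ 1` elliptic curves over `ℚ` — "full BSD
formula for every rank `≤ 1` curve in class `C`" assembled STRICTLY from published theorems — so
that the rank-`≤ 1` remainder becomes exactly the CONSTRUCTION-SHAPED classes, which are TYPED
(missing-input `Prop`s), NOT attempted. This is not "finishing BSD". Team n1011 (N10/N11 with the
O8 image strand): research route; no claim beyond the stated classes; labels UNCHANGED; NOTHING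
booked (a per-pair closure is the referee's ruling on certificates). Theorems only; no
definition, no named fact minted (the input fact is
`Literature.NumberTheory.EllipticCurves.MatarNekovar2019_card_sha_primary_baseChange_of_derivedPoint_not_divisible_of_irreducible`,
`KolyvaginShaStructure.lean`, taken as the explicit binder `hMN`; its flags
`MN19-0.7-0.11-structure-composite`, `Kolyvagin1991-LNM1479-primary-unread` travel with every
theorem here).

## What this file records

The surjective-image sibling (`X4RankZeroLowerKolyvaginDerived.lean`, McCallum 1991 Thm. 5.4) splits
`Ш(E_K/K)[p^∞]` into the parts of `E/ℚ` and of `E^{(d_K)}/ℚ`. Under mere irreducibility the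
printed statement (MN19 Thm. 0.7 via §0.11) gives the TOTAL order only:
`#Ш(E_K/K)[p^∞] = p^{2m₀}` from [`p^{m₀} ∥ y_K` in `E(K)`] and [one Kolyvagin prime `ℓ` with
`P_ℓ ∉ pE(K_ℓ)`]. The tree's odd-part quadratic descent
(`WeierstrassCurve.card_primaryComponent_sha_baseChange_quadratic_of_odd_of_finite`, Jetchev–Skinner–Wan
2017 §7.4.1 / Dokchitser–Dokchitser 2010: `#Ш(E_K/K)[p^∞] = #Ш(E/ℚ)[p^∞]·#Ш(E^{(d_K)}/ℚ)[p^∞]`) then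
gives:
* `card_sha_primary_mul_twist_eq_of_derivedCertificate_of_irr` — the PRODUCT identity
  `#Ш(E/ℚ)[p^∞] · #Ш(E^{(d_K)}/ℚ)[p^∞] = p^{2m₀}` (both factors finite: `E` by GZK in analytic rank
  `≤ 1`, the twist as a hypothesis/instance);
* `card_sha_primary_eq_of_derivedCertificate_of_irr_of_twist` — with ONE more certificate, the
  `p`-part of the twist's `Ш` (`#Ш(E^{(d_K)}/ℚ)[p^∞] = p^{2k}`, e.g. `k = 0` from a `p`-descent of the
  rank-one twist), `#Ш(E/ℚ)[p^∞] = p^{2(m₀ − k)}` EXACTLY;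
* Miller currency: `missingLowerBoundAt_of_derivedCertificate_of_irr`,
  `missingPPartAt_of_derivedCertificate_of_irr`, **`bsdp_of_derivedCertificate_of_irr`**, and the
  X4 reading `ClassX4.bsdp_rankZero_of_derivedCertificate_of_irr` (irreducibility IS the class
  hypothesis `Irr`; no surjectivity, no tower: the O8 rows `3Ns/3Nn/5Ns/5Nn/5S4/7Ns/13S4` and the
  EXOTIC `3`-adic rows are in scope, per pair).
What this does NOT give: the split between `E` and `E^{(d_K)}` without the extra certificate;
anything class-wide. Nothing booked.

References: Matar–Nekovář 2019 [MatarNekovar2019] Thm. 0.7, §0.11; McCallum 1991 [McCallumLMS1991]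
§5; Jetchev–Skinner–Wan 2017 [JetchevSkinnerWan2017] §7.4.1; Dokchitser–Dokchitser 2010
[DokchitserDokchitserAnnals2010] Lemma 4.14; Miller 2011 [Miller2011LMS] Def. 1.1.
-/

noncomputable section

open scoped Classical

open WeierstrassCurve Literature.NumberTheory.EllipticCurves
  Literature.NumberTheory.EllipticCurves.ModularForms
  Literature.NumberTheory.EllipticCurves.Rank1Residual
  Literature.NumberTheory.EllipticCurves.Rank1Residual.Typed

namespace Summit.BirchSwinnertonDyer.Rank1Residual.Additive

variable {W : WeierstrassCurve ℚ} [W.IsElliptic] [W.IsGloballyMinimal] [NeZero (W.conductorNorm ℤ)]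
  {K : Type} [Field K] [NumberField K] {p : ℕ} [hp : Fact p.Prime]
  {Dt : ModularParametrizationData W (W.conductorNorm ℤ)} {β : ℤ} {ι : K →+* ℂ}

/-- **The product identity under irreducible image**: `#Ш(E/ℚ)[p^∞] · #Ш(E^{(d_K)}/ℚ)[p^∞] = p^{2m₀}`
for `E/ℚ` of analytic rank `≤ 1` (so `Ш(E/ℚ)` is finite, GZK `hGZK`), a Heegner field `K`
(`d_K ∉ {−3,−4}`), `p` odd with `E[p]` irreducible, the certificates [`p^{m₀} ∥ y_K` in `E(K)`]
and [`P_ℓ ∉ pE(K_ℓ)`], and a `ℚ`-model `Wd` of the twist with `Ш(Wd/ℚ)[p^∞]` finite: Matar–Nekovář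
Thm. 0.7 / §0.11 (`hMN`, total order over `K`) with the odd-part quadratic descent.
[cite: MatarNekovar2019, Thm. 0.7 and §0.11 (pp. 456–457)]
[cite: JetchevSkinnerWan2017, §7.4.1 (arXiv:1512.06894 p. 30)] -/
theorem card_sha_primary_mul_twist_eq_of_derivedCertificate_of_irr
    (hMN : MatarNekovar2019_card_sha_primary_baseChange_of_derivedPoint_not_divisible_of_irreducible)
    (hGZK : rank_eq_analyticRank_of_analyticRank_le_one)
    (hCM : ¬ W.HasCM) (hK : IsImaginaryQuadratic K) (hD3 : NumberField.discr K ≠ -3)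
    (hD4 : NumberField.discr K ≠ -4) (hH : SatisfiesHeegnerHypothesis (W.conductorNorm ℤ) K)
    (hp2 : p ≠ 2) (hirr : W.HasIrreducibleModPGaloisRep p) (hr : W.analyticRank ≤ 1)
    (d₁ : KolyvaginHeegnerData Dt β ι 1) (P : (W.baseChange K).toAffine.Point)
    (hP : d₁.toGeomPoints d₁.derivedPoint = toGeomPoints (W.baseChange K) P)
    (hy : ¬ IsOfFinAddOrder P) {M₀ : ℕ}
    (hdiv : ∃ Q : (W.baseChange K).toAffine.Point, ((p ^ M₀ : ℕ) : ℤ) • Q = P)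
    (hndiv : ¬ ∃ Q : (W.baseChange K).toAffine.Point, ((p ^ (M₀ + 1) : ℕ) : ℤ) • Q = P)
    {ℓ : ℕ} (d : KolyvaginHeegnerData Dt β ι ℓ)
    (hℓ : Zhang2014.IsKolyvaginPrime (W.conductorNorm ℤ) W K p ℓ)
    (hPℓ : ¬ ∃ Q : (W.baseChange (ringClassField K ι ℓ)).toAffine.Point, (p : ℤ) • Q = d.derivedPoint)
    (Wd : WeierstrassCurve ℚ) [Wd.IsElliptic]
    (hWd : ∃ C : VariableChange ℚ, C • W.quadraticTwist (NumberField.discr K : ℚ) = Wd)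
    [Finite (AddCommGroup.primaryComponent Wd.sha p)] :
    Nat.card (AddCommGroup.primaryComponent W.sha p) *
        Nat.card (AddCommGroup.primaryComponent Wd.sha p) = p ^ (2 * M₀) := by
  haveI : Finite W.sha := (hGZK W hr).2
  haveI : Finite (AddCommGroup.primaryComponent W.sha p) := inferInstance
  haveI : (W.baseChange K).IsElliptic := by rw [baseChange]; infer_instance
  rw [← W.card_primaryComponent_sha_baseChange_quadratic_of_odd_of_finite K hK.1 Wd hWd
    (W.baseChange K) ⟨1, one_smul _ _⟩ p hp2]
  exact hMN W hCM K hK hD3 hD4 hH p hp2 hirr Dt β ι d₁ P hP hy M₀ hdiv hndiv ℓ d hℓ hPℓ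

/-- **Exact `#Ш(E/ℚ)[p^∞]` under irreducible image, with the twist certificate**: if in addition
`#Ш(E^{(d_K)}/ℚ)[p^∞] = p^{2k}` (a per-pair certificate on the twist, e.g. `k = 0`), then
`#Ш(E/ℚ)[p^∞] = p^{2(m₀ − k)}` and `k ≤ m₀`. [cite: MatarNekovar2019, Thm. 0.7 and §0.11 (pp. 456–457)]
[cite: JetchevSkinnerWan2017, §7.4.1 (arXiv:1512.06894 p. 30)] -/
theorem card_sha_primary_eq_of_derivedCertificate_of_irr_of_twist
    (hMN : MatarNekovar2019_card_sha_primary_baseChange_of_derivedPoint_not_divisible_of_irreducible)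
    (hGZK : rank_eq_analyticRank_of_analyticRank_le_one)
    (hCM : ¬ W.HasCM) (hK : IsImaginaryQuadratic K) (hD3 : NumberField.discr K ≠ -3)
    (hD4 : NumberField.discr K ≠ -4) (hH : SatisfiesHeegnerHypothesis (W.conductorNorm ℤ) K)
    (hp2 : p ≠ 2) (hirr : W.HasIrreducibleModPGaloisRep p) (hr : W.analyticRank ≤ 1)
    (d₁ : KolyvaginHeegnerData Dt β ι 1) (P : (W.baseChange K).toAffine.Point)
    (hP : d₁.toGeomPoints d₁.derivedPoint = toGeomPoints (W.baseChange K) P)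
    (hy : ¬ IsOfFinAddOrder P) {M₀ : ℕ}
    (hdiv : ∃ Q : (W.baseChange K).toAffine.Point, ((p ^ M₀ : ℕ) : ℤ) • Q = P)
    (hndiv : ¬ ∃ Q : (W.baseChange K).toAffine.Point, ((p ^ (M₀ + 1) : ℕ) : ℤ) • Q = P)
    {ℓ : ℕ} (d : KolyvaginHeegnerData Dt β ι ℓ)
    (hℓ : Zhang2014.IsKolyvaginPrime (W.conductorNorm ℤ) W K p ℓ)
    (hPℓ : ¬ ∃ Q : (W.baseChange (ringClassField K ι ℓ)).toAffine.Point, (p : ℤ) • Q = d.derivedPoint)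
    (Wd : WeierstrassCurve ℚ) [Wd.IsElliptic]
    (hWd : ∃ C : VariableChange ℚ, C • W.quadraticTwist (NumberField.discr K : ℚ) = Wd)
    {k : ℕ} (htw : Nat.card (AddCommGroup.primaryComponent Wd.sha p) = p ^ (2 * k)) :
    k ≤ M₀ ∧ Nat.card (AddCommGroup.primaryComponent W.sha p) = p ^ (2 * (M₀ - k)) := by
  haveI : Finite (AddCommGroup.primaryComponent Wd.sha p) :=
    (Nat.card_pos_iff.mp (by rw [htw]; exact pow_pos hp.out.pos _)).2
  have hprod := card_sha_primary_mul_twist_eq_of_derivedCertificate_of_irr hMN hGZK hCM hK hD3 hD4 hH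
    hp2 hirr hr d₁ P hP hy hdiv hndiv d hℓ hPℓ Wd hWd
  rw [htw] at hprod
  have hp1 : 1 < p := hp.out.one_lt
  -- `a · p^{2k} = p^{2M₀}` with `a` a natural number forces `2k ≤ 2M₀` and `a = p^{2M₀ − 2k}`
  have hdvd : p ^ (2 * k) ∣ p ^ (2 * M₀) := Dvd.intro_left _ hprod
  have hle : 2 * k ≤ 2 * M₀ := (Nat.pow_dvd_pow_iff_le_right hp1).mp hdvd
  refine ⟨by omega, ?_⟩
  have hpow : p ^ (2 * M₀) = p ^ (2 * (M₀ - k)) * p ^ (2 * k) := by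
    rw [← pow_add]; congr 1; omega
  rw [hpow] at hprod
  exact Nat.eq_of_mul_eq_mul_right (pow_pos hp.out.pos _) hprod

/-- **The LOWER half under irreducible image**: `Typed.MissingLowerBoundAt W p` for `E/ℚ` of
analytic rank `0` from the derived-point certificate, the twist certificate `#Ш(E^{(d_K)})[p^∞] = p^{2k}`
and the census value `#Ш_an = q` with `ord_p q ≤ 2(m₀ − k)`.
[cite: MatarNekovar2019, Thm. 0.7 and §0.11 (pp. 456–457)] [cite: Miller2011LMS, Def. 1.1] -/
theorem missingLowerBoundAt_of_derivedCertificate_of_irr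
    (hMN : MatarNekovar2019_card_sha_primary_baseChange_of_derivedPoint_not_divisible_of_irreducible)
    (hGZK : rank_eq_analyticRank_of_analyticRank_le_one)
    (hCM : ¬ W.HasCM) (hK : IsImaginaryQuadratic K) (hD3 : NumberField.discr K ≠ -3)
    (hD4 : NumberField.discr K ≠ -4) (hH : SatisfiesHeegnerHypothesis (W.conductorNorm ℤ) K)
    (hp2 : p ≠ 2) (hirr : W.HasIrreducibleModPGaloisRep p) (hr : W.analyticRank = 0)
    (d₁ : KolyvaginHeegnerData Dt β ι 1) (P : (W.baseChange K).toAffine.Point)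
    (hP : d₁.toGeomPoints d₁.derivedPoint = toGeomPoints (W.baseChange K) P)
    (hy : ¬ IsOfFinAddOrder P) {M₀ : ℕ}
    (hdiv : ∃ Q : (W.baseChange K).toAffine.Point, ((p ^ M₀ : ℕ) : ℤ) • Q = P)
    (hndiv : ¬ ∃ Q : (W.baseChange K).toAffine.Point, ((p ^ (M₀ + 1) : ℕ) : ℤ) • Q = P)
    {ℓ : ℕ} (d : KolyvaginHeegnerData Dt β ι ℓ)
    (hℓ : Zhang2014.IsKolyvaginPrime (W.conductorNorm ℤ) W K p ℓ)
    (hPℓ : ¬ ∃ Q : (W.baseChange (ringClassField K ι ℓ)).toAffine.Point, (p : ℤ) • Q = d.derivedPoint)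
    (Wd : WeierstrassCurve ℚ) [Wd.IsElliptic]
    (hWd : ∃ C : VariableChange ℚ, C • W.quadraticTwist (NumberField.discr K : ℚ) = Wd)
    {k : ℕ} (htw : Nat.card (AddCommGroup.primaryComponent Wd.sha p) = p ^ (2 * k))
    {q : ℚ} (hq : shaAn W = (q : ℂ)) (hv : padicValRat p q ≤ ((2 * (M₀ - k) : ℕ) : ℤ)) :
    MissingLowerBoundAt W p := by
  haveI : Finite W.sha := (hGZK W (by rw [hr]; exact zero_le_one)).2
  obtain ⟨-, hcard⟩ := card_sha_primary_eq_of_derivedCertificate_of_irr_of_twist hMN hGZK hCM hK hD3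
    hD4 hH hp2 hirr (by rw [hr]; exact zero_le_one) d₁ P hP hy hdiv hndiv d hℓ hPℓ Wd hWd htw
  refine ⟨q, hq, ?_⟩
  rw [WeierstrassCurve.shaOrder, ← padicValNat_card_addPrimaryComponent (A := W.sha) p, hcard,
    padicValNat.prime_pow]
  exact_mod_cast hv

/-- **The whole `p`-part under irreducible image**: `Typed.MissingPPartAt W p` when
`ord_p #Ш_an = 2(m₀ − k)`. [cite: MatarNekovar2019, Thm. 0.7 and §0.11 (pp. 456–457)]
[cite: Miller2011LMS, Def. 1.1] -/
theorem missingPPartAt_of_derivedCertificate_of_irr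
    (hMN : MatarNekovar2019_card_sha_primary_baseChange_of_derivedPoint_not_divisible_of_irreducible)
    (hGZK : rank_eq_analyticRank_of_analyticRank_le_one)
    (hCM : ¬ W.HasCM) (hK : IsImaginaryQuadratic K) (hD3 : NumberField.discr K ≠ -3)
    (hD4 : NumberField.discr K ≠ -4) (hH : SatisfiesHeegnerHypothesis (W.conductorNorm ℤ) K)
    (hp2 : p ≠ 2) (hirr : W.HasIrreducibleModPGaloisRep p) (hr : W.analyticRank = 0)
    (d₁ : KolyvaginHeegnerData Dt β ι 1) (P : (W.baseChange K).toAffine.Point)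
    (hP : d₁.toGeomPoints d₁.derivedPoint = toGeomPoints (W.baseChange K) P)
    (hy : ¬ IsOfFinAddOrder P) {M₀ : ℕ}
    (hdiv : ∃ Q : (W.baseChange K).toAffine.Point, ((p ^ M₀ : ℕ) : ℤ) • Q = P)
    (hndiv : ¬ ∃ Q : (W.baseChange K).toAffine.Point, ((p ^ (M₀ + 1) : ℕ) : ℤ) • Q = P)
    {ℓ : ℕ} (d : KolyvaginHeegnerData Dt β ι ℓ)
    (hℓ : Zhang2014.IsKolyvaginPrime (W.conductorNorm ℤ) W K p ℓ)
    (hPℓ : ¬ ∃ Q : (W.baseChange (ringClassField K ι ℓ)).toAffine.Point, (p : ℤ) • Q = d.derivedPoint)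
    (Wd : WeierstrassCurve ℚ) [Wd.IsElliptic]
    (hWd : ∃ C : VariableChange ℚ, C • W.quadraticTwist (NumberField.discr K : ℚ) = Wd)
    {k : ℕ} (htw : Nat.card (AddCommGroup.primaryComponent Wd.sha p) = p ^ (2 * k))
    {q : ℚ} (hq : shaAn W = (q : ℂ)) (hv : padicValRat p q = ((2 * (M₀ - k) : ℕ) : ℤ)) :
    MissingPPartAt W p := by
  haveI : Finite W.sha := (hGZK W (by rw [hr]; exact zero_le_one)).2
  obtain ⟨-, hcard⟩ := card_sha_primary_eq_of_derivedCertificate_of_irr_of_twist hMN hGZK hCM hK hD3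
    hD4 hH hp2 hirr (by rw [hr]; exact zero_le_one) d₁ P hP hy hdiv hndiv d hℓ hPℓ Wd hWd htw
  refine ⟨q, hq, ?_⟩
  rw [WeierstrassCurve.shaOrder, ← padicValNat_card_addPrimaryComponent (A := W.sha) p, hcard,
    padicValNat.prime_pow]
  exact_mod_cast hv

/-- **`BSD(E,p)` under irreducible image from the derived-point certificate, the twist certificate
and `ord_p #Ш_an = 2(m₀ − k)`** — class-agnostic (ANY reduction at `p`), image hypothesis =
irreducibility only: the per-pair route that reaches the O8 rows (non-surjective irreducible
image at the additive prime) and the EXOTIC `3`-adic rows, which no Euler-system or Kolyvagin-system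
statement in print reaches (PLAN R3-7). [cite: MatarNekovar2019, Thm. 0.7 and §0.11 (pp. 456–457)]
[cite: Miller2011LMS, §1 and Def. 1.1] -/
theorem bsdp_of_derivedCertificate_of_irr
    (hMN : MatarNekovar2019_card_sha_primary_baseChange_of_derivedPoint_not_divisible_of_irreducible)
    (hGZK : rank_eq_analyticRank_of_analyticRank_le_one)
    (hCM : ¬ W.HasCM) (hK : IsImaginaryQuadratic K) (hD3 : NumberField.discr K ≠ -3)
    (hD4 : NumberField.discr K ≠ -4) (hH : SatisfiesHeegnerHypothesis (W.conductorNorm ℤ) K)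
    (hp2 : p ≠ 2) (hirr : W.HasIrreducibleModPGaloisRep p) (hr : W.analyticRank = 0)
    (d₁ : KolyvaginHeegnerData Dt β ι 1) (P : (W.baseChange K).toAffine.Point)
    (hP : d₁.toGeomPoints d₁.derivedPoint = toGeomPoints (W.baseChange K) P)
    (hy : ¬ IsOfFinAddOrder P) {M₀ : ℕ}
    (hdiv : ∃ Q : (W.baseChange K).toAffine.Point, ((p ^ M₀ : ℕ) : ℤ) • Q = P)
    (hndiv : ¬ ∃ Q : (W.baseChange K).toAffine.Point, ((p ^ (M₀ + 1) : ℕ) : ℤ) • Q = P)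
    {ℓ : ℕ} (d : KolyvaginHeegnerData Dt β ι ℓ)
    (hℓ : Zhang2014.IsKolyvaginPrime (W.conductorNorm ℤ) W K p ℓ)
    (hPℓ : ¬ ∃ Q : (W.baseChange (ringClassField K ι ℓ)).toAffine.Point, (p : ℤ) • Q = d.derivedPoint)
    (Wd : WeierstrassCurve ℚ) [Wd.IsElliptic]
    (hWd : ∃ C : VariableChange ℚ, C • W.quadraticTwist (NumberField.discr K : ℚ) = Wd)
    {k : ℕ} (htw : Nat.card (AddCommGroup.primaryComponent Wd.sha p) = p ^ (2 * k))
    {q : ℚ} (hq : shaAn W = (q : ℂ)) (hv : padicValRat p q = ((2 * (M₀ - k) : ℕ) : ℤ)) : BSDp W p :=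
  bsdp_of_missingPPartAt W p hGZK (by rw [hr]; exact zero_le_one)
    (missingPPartAt_of_derivedCertificate_of_irr hMN hGZK hCM hK hD3 hD4 hH hp2 hirr hr d₁ P hP hy
      hdiv hndiv d hℓ hPℓ Wd hWd htw hq hv)

/-- **X4 reading (O8 / EXOTIC rows included): `BSD(E,p)` on an X4 pair of analytic rank `0` from
the derived-point certificate with IRREDUCIBLE image only** — `Irr W p` is the class's own
hypothesis; no surjectivity, no tower. [cite: MatarNekovar2019, Thm. 0.7 and §0.11 (pp. 456–457)]
[cite: Miller2011LMS, §1 and Def. 1.1] -/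
theorem ClassX4.bsdp_rankZero_of_derivedCertificate_of_irr (hX : ClassX4 W p)
    (hMN : MatarNekovar2019_card_sha_primary_baseChange_of_derivedPoint_not_divisible_of_irreducible)
    (hGZK : rank_eq_analyticRank_of_analyticRank_le_one)
    (hCM : ¬ W.HasCM) (hK : IsImaginaryQuadratic K) (hD3 : NumberField.discr K ≠ -3)
    (hD4 : NumberField.discr K ≠ -4) (hH : SatisfiesHeegnerHypothesis (W.conductorNorm ℤ) K)
    (hr : W.analyticRank = 0)
    (d₁ : KolyvaginHeegnerData Dt β ι 1) (P : (W.baseChange K).toAffine.Point)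
    (hP : d₁.toGeomPoints d₁.derivedPoint = toGeomPoints (W.baseChange K) P)
    (hy : ¬ IsOfFinAddOrder P) {M₀ : ℕ}
    (hdiv : ∃ Q : (W.baseChange K).toAffine.Point, ((p ^ M₀ : ℕ) : ℤ) • Q = P)
    (hndiv : ¬ ∃ Q : (W.baseChange K).toAffine.Point, ((p ^ (M₀ + 1) : ℕ) : ℤ) • Q = P)
    {ℓ : ℕ} (d : KolyvaginHeegnerData Dt β ι ℓ)
    (hℓ : Zhang2014.IsKolyvaginPrime (W.conductorNorm ℤ) W K p ℓ)
    (hPℓ : ¬ ∃ Q : (W.baseChange (ringClassField K ι ℓ)).toAffine.Point, (p : ℤ) • Q = d.derivedPoint)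
    (Wd : WeierstrassCurve ℚ) [Wd.IsElliptic]
    (hWd : ∃ C : VariableChange ℚ, C • W.quadraticTwist (NumberField.discr K : ℚ) = Wd)
    {k : ℕ} (htw : Nat.card (AddCommGroup.primaryComponent Wd.sha p) = p ^ (2 * k))
    {q : ℚ} (hq : shaAn W = (q : ℂ)) (hv : padicValRat p q = ((2 * (M₀ - k) : ℕ) : ℤ)) : BSDp W p :=
  bsdp_of_derivedCertificate_of_irr hMN hGZK hCM hK hD3 hD4 hH hX.1 hX.2.2 hr d₁ P hP hy hdiv hndiv d
    hℓ hPℓ Wd hWd htw hq hv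

end Summit.BirchSwinnertonDyer.Rank1Residual.Additive

end
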